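import Literature.MathematicalPhysics.QuantumFieldTheory.BalabanImbrieJaffe1984to88.BIJ88EndChainFluct309

/-!
# `BalabanImbrieJaffe1984to88.BIJ88EndChainNFluct309` — T. Bałaban, J. Imbrie, A. Jaffe, *Effective action and cluster properties of the abelian
Higgs model*, Commun. Math. Phys. **114** (1988) 257–315 [BalabanImbrieJaffe1988], Sect. 5.13 p. 305–307 [PDF 49–51] with Sect. 5.14 (5.14.4)
p. 309–310 [PDF 53–54] and [Balaban1982Higgs2] (2.28)–(2.29) p. 563: **THE FAR-CUBE FLUCTUATION BOUND ON END-DECORATED CHAINS OF ANY LENGTH,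
SIZE-UNIFORM** — the three-cube chain of `BIJ88EndChainFluct309` generalized to a chain `X″` of `N` cubes `□_a – □_b – ⋯ – □_n` KEEPING THE DECAY
EXPONENT: the decorated cube `□_a ∈ X″`, its ONE neighbour cube `□_b` inside `X″` (the only cube of `X″ ∖ {a}` coupled to `□_a` by `Δ`), the far
cube `□_n ∈ X″` not coupled to `□_a`, interpolation parameters `s ∈ [0,1]^I` supported in `X″`, conditioning on `Λ` = the sites off `□_a`.  From
the pointwise decay letter (b) for the restricted inverse `|(A_Λ)⁻¹(x,l)| ≤ c₁δ^{d(x,l)}`, the geometry letters W (sites per cube) and R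
(off-diagonal row sums of `Δ`), and the chain's one geometric fact — the sites of `□_n` and the sites of `X″` coupled to `□_n` lie `≥ D` cube-side
units from the sites of `□_b` coupled to `□_a` (on a collinear chain of `N` cubes of side `r` with nearest-neighbour `Δ` these are the first layer
of `□_b` and the last layer of the `(N−1)`-st cube resp. `□_n`, `≥ (N−2)r − 1 ≥ (N−2)(r−1)` lattice units apart: `D = N − 2` in units `ℓ = r − 1`):

  `Σ_k |T_{xk}| ≤ W·c₁δ^D·R`  for `x ∈ □_n` or `x` a site of an `X″`-cube coupled to `□_n`      (`rowSum_boundary_le_chainN`),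
  `⟨|D_n∘cm − D_n(cm₀)|⟩_s ≤ W·R·(Wc₁δ^D R)²/m`  (sourceless class `ℱ = 0`)      (`fluct_le_chainN`),

i.e. print's count — the walk from `□_a` to `□_n` must CROSS every cube in between and picks up one factor `δ = e^{−cr(e_k)}` per cube (p. 307:
*"If the walk ω(α) wanders through more than a few cubes, we begin to pickup factors e^{−cr(e_k)}"*; p. 310: *"The others, localized in region X,
have a factor of e^{−cr(e_k)|X|}"*) — where `BIJ88EndPolyFluct309` bounded `δ^{d(x,l)} ≤ δ` once and counted `|X″|·W` rows (owner r16's flag,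
HOME/lit-balaban-p36/INBOX.md 2026-08-23T09:33Z: that regime is size-dependent).  With the far-cube engine `BIJ88ActInFarCube309.
abs_actIn_le_of_condMean_fluct` this gives (5.14.4) located on end-decorated chains of EVERY length from two size-free clauses
(`BIJ88Ineq5144EndChainNDecay`, this generation).

statement-level skeleton of published theorems with citation tags; proofs where landed; nothing here is a claim about the Yang–Mills mass gap

PDF held: `paper:balaban1988-cmp114-bij-abelian-higgs-effective-action` (journal page = PDF page + 256); p. 307 (p0051) and p. 310 (p0054) as quoted.

WHAT IS PROVED (unit `lit-balaban-p36`, generation 20 of the Phase-2 proof seat p36; SKELETON rows C2.Eq5.14.3-5.14.4 / C2.Eq5.13.3-5.13.4 of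
`HOME/lit-balaban-r16/ROWS-C2-part2.md`, owner r16; 0 definitions, 0 `Prop` facts, theorems only).
* **`rowSum_boundary_le_chainN`**, **`fluct_le_chainN`** (reusing `BIJ88EndChainFluct309.majorant_le_of_rows`, `sum_sum_abs_le`,
  `abs_interpForm_apply_le`, `interpForm_apply_eq_zero`).
HONEST SCOPE: sourceless class; the neighbour clause (`□_b` the only cube of `X″ ∖ {a}` coupled to `□_a`) and the depth clause (`d ≥ D`) are
hypotheses — they hold with `D = N − 2` for collinear chains of cubes with nearest-neighbour coupling; for a branched end-decorated polymer `D` is the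
cube-graph distance from `□_b` to the `□_n`-end, which pays only the cubes ON THE PATH `a → n`.  Imports `BIJ88EndChainFluct309` (p36 g19); modifies
nothing.  NOT summit progress; NOT continuum; NOT Clay.  Cell `lit-balaban` Phase 2, seat p36 gen 20 (owner r16, referee ref-5).
-/

noncomputable section

open Finset MeasureTheory Matrix Function Filter
open Literature.MathematicalPhysics.QuantumFieldTheory.Balaban1983to89
open Literature.MathematicalPhysics.QuantumFieldTheory.BalabanImbrieJaffe1984to88
open B2Eq228Conditioning (In Out resIn resOut glue blkIn blkMix condShift)
open BIJ88DirichletForms305 (interpForm interpForm_apply interpForm_posDef quadForm_interpForm_ge)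
open BIJ88PolymerRep5134 (corner)
open BIJ88PolymerRep5134GaussWitness (corner_mem_cube)
open BIJ88SecondOrder5133 (num Dfun)
open BIJ88ExpectTilt305 (inv_apply_self_le)
open BIJ88DexpCondMeanMajorant305 (expect_abs_Dfun_cm_sub_le)
open BIJ88EndChainFluct309 (abs_interpForm_apply_le interpForm_apply_eq_zero majorant_le_of_rows sum_sum_abs_le)

namespace Literature.MathematicalPhysics.QuantumFieldTheory.BalabanImbrieJaffe1984to88.BIJ88EndChainNFluct309

variable {α I : Type} [Fintype α] [DecidableEq α] [Fintype I] [DecidableEq I] (blk : α → I) {Δ : Matrix α α ℝ}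

/-! ## §1 Rows of the boundary operator on an end-decorated chain, the decay exponent kept -/

/-- **`Σ_k |T_{xk}| ≤ W·c₁δ^D·R` on an end-decorated chain** for `T = A_Λ⁻¹A_{ΛΛᶜ}`, `A = (Δ_{1_{Λ′}})_s`, `Λ = {x | □x ≠ a}`, `s ∈ [0,1]^I`
supported in `X″`, and `x ∈ □_n` or `x` a site of an `X″`-cube coupled to `□_n`: only the sites `l ∈ □_b` coupled to `□_a` carry a nonzero row
of `A_{ΛΛᶜ}` (`□_b` is the only cube of `X″ ∖ {a}` coupled to `□_a`; the cubes off `X″` have `s = 0`), each such row sums to `≤ R`, there are `≤ W`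
of them, and for them the decay letter gives `|(A_Λ)⁻¹(x,l)| ≤ c₁δ^{d(x,l)} ≤ c₁δ^D` (`d(x,l) ≥ D`: the chain's depth).
[cite: BalabanImbrieJaffe1988, §5.13 p.307; (5.14.4) p.309–310] -/
theorem rowSum_boundary_le_chainN {a b n : I} (hab : a ≠ b) (X'' : Finset I)
    (hnbr : ∀ l k, blk l ∈ X'' → blk l ≠ a → blk k = a → Δ l k ≠ 0 → blk l = b)
    {W : ℕ} (hW : ∀ i, (univ.filter fun x : α => blk x = i).card ≤ W)
    {R : ℝ} (hR0 : 0 ≤ R) (hR : ∀ x, ∑ y ∈ univ.filter (fun y => blk y ≠ blk x), |Δ x y| ≤ R)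
    (ds : α → α → ℕ) {c₁ δ : ℝ} (hc₁ : 0 ≤ c₁) (hδ0 : 0 ≤ δ) (hδ1 : δ ≤ 1) (D : ℕ)
    (hgeo : ∀ x l, (blk x = n ∨ (blk x ∈ X'' ∧ ∃ y, blk y = n ∧ Δ y x ≠ 0)) → blk l = b → (∃ k, blk k = a ∧ Δ l k ≠ 0) → D ≤ ds x l)
    (Λc : Finset I) {s : I → ℝ} (hs : ∀ l, 0 ≤ s l ∧ s l ≤ 1) (hs0 : ∀ l, l ∉ X'' → s l = 0)
    (hdec : ∀ x l : In (fun x => blk x ≠ a),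
      |(blkIn (fun x => blk x ≠ a) (interpForm blk (interpForm blk Δ (corner ℝ Λc)) s))⁻¹ x l| ≤ c₁ * δ ^ ds x.1 l.1)
    (x : In (fun x => blk x ≠ a)) (hx : blk x.1 = n ∨ (blk x.1 ∈ X'' ∧ ∃ y, blk y = n ∧ Δ y x.1 ≠ 0)) :
    ∑ k : Out (fun x => blk x ≠ a), |((blkIn (fun x => blk x ≠ a) (interpForm blk (interpForm blk Δ (corner ℝ Λc)) s))⁻¹ *
        blkMix (fun x => blk x ≠ a) (interpForm blk (interpForm blk Δ (corner ℝ Λc)) s)) x k| ≤ W * (c₁ * δ ^ D * R) := by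
  have hk : ∀ k : Out (fun x => blk x ≠ a), blk k.1 = a := fun k => not_ne_iff.1 k.2
  have hcs := corner_mem_cube (I := I) Λc
  -- the entries of `A_{ΛΛᶜ}`: `A(l,k) = s_{□l} s_a (Δ_{1_{Λ′}})_{lk}`
  have hAlk : ∀ (l : In (fun x => blk x ≠ a)) (k : Out (fun x => blk x ≠ a)),
      interpForm blk (interpForm blk Δ (corner ℝ Λc)) s l.1 k.1 = s (blk l.1) * s a * interpForm blk Δ (corner ℝ Λc) l.1 k.1 := by
    intro l k
    rw [interpForm_apply, if_neg (by rw [hk k]; exact l.2), hk k]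
  have hAabs : ∀ (l : In (fun x => blk x ≠ a)) (k : Out (fun x => blk x ≠ a)),
      |interpForm blk (interpForm blk Δ (corner ℝ Λc)) s l.1 k.1| ≤ |Δ l.1 k.1| := fun l k => by
    rw [hAlk, abs_mul, abs_mul, abs_of_nonneg (hs _).1, abs_of_nonneg (hs _).1]
    exact (mul_le_of_le_one_left (abs_nonneg _) (mul_le_one₀ (hs _).2 (hs _).1 (hs _).2)).trans
      (abs_interpForm_apply_le blk Δ hcs _ _)
  -- the row of `A_{ΛΛᶜ}` at `l ∈ □_b` sums to `≤ R`
  have hrowR : ∀ l : In (fun x => blk x ≠ a), blk l.1 = b →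
      ∑ k : Out (fun x => blk x ≠ a), |interpForm blk (interpForm blk Δ (corner ℝ Λc)) s l.1 k.1| ≤ R := by
    intro l hlb
    have hmap : (univ : Finset (Out (fun x => blk x ≠ a))).map (Embedding.subtype _) ⊆ univ.filter (fun y => blk y ≠ blk l.1) := by
      intro y hy
      rw [Finset.mem_map] at hy
      obtain ⟨k, -, rfl⟩ := hy
      refine mem_filter.2 ⟨mem_univ _, ?_⟩
      rw [Embedding.coe_subtype, hk k, hlb]
      exact hab
    calc ∑ k : Out (fun x => blk x ≠ a), |interpForm blk (interpForm blk Δ (corner ℝ Λc)) s l.1 k.1|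
        ≤ ∑ k : Out (fun x => blk x ≠ a), |Δ l.1 k.1| := sum_le_sum fun k _ => hAabs l k
      _ = ∑ y ∈ (univ : Finset (Out (fun x => blk x ≠ a))).map (Embedding.subtype _), |Δ l.1 y| := by rw [sum_map]; rfl
      _ ≤ ∑ y ∈ univ.filter (fun y => blk y ≠ blk l.1), |Δ l.1 y| := sum_le_sum_of_subset_of_nonneg hmap fun _ _ _ => abs_nonneg _
      _ ≤ R := hR l.1
  -- and vanishes unless `l ∈ □_b` is coupled to `□_a`
  have hrow0 : ∀ l : In (fun x => blk x ≠ a), ¬ (blk l.1 = b ∧ ∃ k, blk k = a ∧ Δ l.1 k ≠ 0) →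
      ∑ k : Out (fun x => blk x ≠ a), |interpForm blk (interpForm blk Δ (corner ℝ Λc)) s l.1 k.1| = 0 := by
    intro l hl
    refine sum_eq_zero fun k _ => ?_
    rw [abs_eq_zero, hAlk]
    by_cases hlX : blk l.1 ∈ X''
    · have h0 : Δ l.1 k.1 = 0 := by
        by_contra h
        exact hl ⟨hnbr l.1 k.1 hlX l.2 (hk k) h, k.1, hk k, h⟩
      rw [interpForm_apply_eq_zero blk Δ _ h0, mul_zero]
    · rw [hs0 _ hlX, zero_mul, zero_mul]
  -- each `l` contributes `≤ c₁δ^D R` if `□l = b`, else nothing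
  have hl : ∀ l : In (fun x => blk x ≠ a),
      |(blkIn (fun x => blk x ≠ a) (interpForm blk (interpForm blk Δ (corner ℝ Λc)) s))⁻¹ x l| *
          ∑ k : Out (fun x => blk x ≠ a), |interpForm blk (interpForm blk Δ (corner ℝ Λc)) s l.1 k.1|
        ≤ if blk l.1 = b then c₁ * δ ^ D * R else 0 := by
    intro l
    by_cases hcpl : blk l.1 = b ∧ ∃ k, blk k = a ∧ Δ l.1 k ≠ 0
    · rw [if_pos hcpl.1]
      have h1 : |(blkIn (fun x => blk x ≠ a) (interpForm blk (interpForm blk Δ (corner ℝ Λc)) s))⁻¹ x l| ≤ c₁ * δ ^ D :=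
        (hdec x l).trans (mul_le_mul_of_nonneg_left (pow_le_pow_of_le_one hδ0 hδ1 (hgeo x.1 l.1 hx hcpl.1 hcpl.2)) hc₁)
      calc _ ≤ (c₁ * δ ^ D) * R :=
            mul_le_mul h1 (hrowR l hcpl.1) (sum_nonneg fun _ _ => abs_nonneg _) (mul_nonneg hc₁ (pow_nonneg hδ0 _))
        _ = c₁ * δ ^ D * R := by ring
    · rw [hrow0 l hcpl, mul_zero]
      split_ifs
      · exact mul_nonneg (mul_nonneg hc₁ (pow_nonneg hδ0 _)) hR0
      · exact le_rfl
  -- at most `W` sites in `□_b`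
  have hcardW : (((univ : Finset (In (fun x => blk x ≠ a))).filter fun l => blk l.1 = b).card : ℝ) ≤ W := by
    have h : ((univ : Finset (In (fun x => blk x ≠ a))).filter fun l => blk l.1 = b).card ≤ (univ.filter fun y : α => blk y = b).card :=
      card_le_card_of_injOn (fun l => l.1)
        (fun l hl => by
          simp only [coe_filter, mem_univ, true_and, Set.mem_setOf_eq] at hl ⊢
          exact hl)
        (fun l₁ _ l₂ _ h => Subtype.ext h)
    exact_mod_cast h.trans (hW b)
  calc ∑ k : Out (fun x => blk x ≠ a), |((blkIn (fun x => blk x ≠ a) (interpForm blk (interpForm blk Δ (corner ℝ Λc)) s))⁻¹ *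
          blkMix (fun x => blk x ≠ a) (interpForm blk (interpForm blk Δ (corner ℝ Λc)) s)) x k|
      = ∑ k : Out (fun x => blk x ≠ a), |∑ l, (blkIn (fun x => blk x ≠ a) (interpForm blk (interpForm blk Δ (corner ℝ Λc)) s))⁻¹ x l *
          interpForm blk (interpForm blk Δ (corner ℝ Λc)) s l.1 k.1| := by
        simp only [Matrix.mul_apply, blkMix, Matrix.submatrix_apply]
    _ ≤ ∑ k : Out (fun x => blk x ≠ a), ∑ l, |(blkIn (fun x => blk x ≠ a) (interpForm blk (interpForm blk Δ (corner ℝ Λc)) s))⁻¹ x l| *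
          |interpForm blk (interpForm blk Δ (corner ℝ Λc)) s l.1 k.1| :=
        sum_le_sum fun k _ => (abs_sum_le_sum_abs _ _).trans (le_of_eq (sum_congr rfl fun l _ => abs_mul _ _))
    _ = ∑ l, |(blkIn (fun x => blk x ≠ a) (interpForm blk (interpForm blk Δ (corner ℝ Λc)) s))⁻¹ x l| *
          ∑ k : Out (fun x => blk x ≠ a), |interpForm blk (interpForm blk Δ (corner ℝ Λc)) s l.1 k.1| := by
        rw [sum_comm]; simp only [mul_sum]
    _ ≤ ∑ l : In (fun x => blk x ≠ a), (if blk l.1 = b then c₁ * δ ^ D * R else 0) := sum_le_sum fun l _ => hl l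
    _ = (((univ : Finset (In (fun x => blk x ≠ a))).filter fun l => blk l.1 = b).card : ℝ) * (c₁ * δ ^ D * R) := by
        rw [← sum_filter, sum_const, nsmul_eq_mul]
    _ ≤ W * (c₁ * δ ^ D * R) := mul_le_mul_of_nonneg_right hcardW (mul_nonneg (mul_nonneg hc₁ (pow_nonneg hδ0 _)) hR0)

/-! ## §2 The fluctuation of the far cube's pulled-down factor on an end-decorated chain -/

/-- **`⟨|D_n∘cm − D_n(cm₀)|⟩_s ≤ W·R·(Wc₁δ^D R)²/m` on a sourceless end-decorated chain** (`ℱ = 0`; `Δ ≻ 0`, `Δ ≥ m·1`; `□_n` not coupled to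
`□_a`; `□_b` the only cube of `X″ ∖ {a}` coupled to `□_a`; W, R; the decay letter (b) at `s`; depth `D`; `s ∈ [0,1]^I` supported in `X″`): the
majorant `expect_abs_Dfun_cm_sub_le` with vanishing drifts, `(Δ_s⁻¹)_{kk} ≤ 1/m`, the pairs `x ∈ □_n`, `y` a site of an `X″`-cube coupled to
`□_n` (`≤ W·R` in `|Δ_{xy}|`-weight) and both rows of `T` bounded by §1 — the factor `δ^{2D}` is print's `e^{−cr(e_k)}` per cube crossed, twice
(once for the response of `□_n`'s conditional mean to `□_a`, once for that of its partner's). [cite: BalabanImbrieJaffe1988, §5.13 p.307; (5.14.4) p.309–310] -/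
theorem fluct_le_chainN (hΔ : Δ.PosDef) {m : ℝ} (hm : 0 < m) (hΔm : ∀ φ : α → ℝ, m * (φ ⬝ᵥ φ) ≤ φ ⬝ᵥ (Δ *ᵥ φ))
    {a b n : I} (hab : a ≠ b) (han : a ≠ n) (X'' : Finset I) (hfar : ∀ x y, blk x = n → blk y = a → Δ x y = 0)
    (hnbr : ∀ l k, blk l ∈ X'' → blk l ≠ a → blk k = a → Δ l k ≠ 0 → blk l = b)
    {W : ℕ} (hW : ∀ i, (univ.filter fun x : α => blk x = i).card ≤ W)
    {R : ℝ} (hR0 : 0 ≤ R) (hR : ∀ x, ∑ y ∈ univ.filter (fun y => blk y ≠ blk x), |Δ x y| ≤ R)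
    (ds : α → α → ℕ) {c₁ δ : ℝ} (hc₁ : 0 ≤ c₁) (hδ0 : 0 ≤ δ) (hδ1 : δ ≤ 1) (D : ℕ)
    (hgeo : ∀ x l, (blk x = n ∨ (blk x ∈ X'' ∧ ∃ y, blk y = n ∧ Δ y x ≠ 0)) → blk l = b → (∃ k, blk k = a ∧ Δ l k ≠ 0) → D ≤ ds x l)
    (Λc : Finset I) {s : I → ℝ} (hs : ∀ l, 0 ≤ s l ∧ s l ≤ 1) (hs0 : ∀ l, l ∉ X'' → s l = 0)
    (hdec : ∀ x l : In (fun x => blk x ≠ a),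
      |(blkIn (fun x => blk x ≠ a) (interpForm blk (interpForm blk Δ (corner ℝ Λc)) s))⁻¹ x l| ≤ c₁ * δ ^ ds x.1 l.1) :
    num blk (interpForm blk Δ (corner ℝ Λc)) 0 (fun φ => |Dfun blk (interpForm blk Δ (corner ℝ Λc)) s n
          (glue (fun x => blk x ≠ a) (condShift (fun x => blk x ≠ a) (interpForm blk (interpForm blk Δ (corner ℝ Λc)) s) 0
            (resOut (fun x => blk x ≠ a) φ)) (resOut (fun x => blk x ≠ a) φ))
        - Dfun blk (interpForm blk Δ (corner ℝ Λc)) s n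
          (glue (fun x => blk x ≠ a) ((blkIn (fun x => blk x ≠ a) (interpForm blk (interpForm blk Δ (corner ℝ Λc)) s))⁻¹ *ᵥ
            resIn (fun x => blk x ≠ a) 0) 0)|) s
        / num blk (interpForm blk Δ (corner ℝ Λc)) 0 (fun _ => 1) s
      ≤ W * R * ((W * (c₁ * δ ^ D * R)) ^ 2 * m⁻¹) := by
  have hcs := corner_mem_cube (I := I) Λc
  have hΔc : (interpForm blk Δ (corner ℝ Λc)).PosDef := interpForm_posDef blk hΔ hcs
  have hmΔc : ∀ φ : α → ℝ, m * (φ ⬝ᵥ φ) ≤ φ ⬝ᵥ (interpForm blk Δ (corner ℝ Λc) *ᵥ φ) := quadForm_interpForm_ge blk hΔm hcs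
  have hA : (interpForm blk (interpForm blk Δ (corner ℝ Λc)) s).PosDef := interpForm_posDef blk hΔc hs
  have hmA : ∀ v : α → ℝ, m * (v ⬝ᵥ v) ≤ v ⬝ᵥ (interpForm blk (interpForm blk Δ (corner ℝ Λc)) s *ᵥ v) :=
    quadForm_interpForm_ge blk hmΔc hs
  have hPn : ∀ x, blk x = n → (fun x => blk x ≠ a) x := fun x hx h => han (h.symm.trans hx)
  have hfar' : ∀ x y, blk x = n → ¬ (fun x => blk x ≠ a) y → interpForm blk Δ (corner ℝ Λc) x y = 0 :=
    fun x y hx hy => interpForm_apply_eq_zero blk Δ _ (hfar x y hx (not_ne_iff.1 hy))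
  have hmaj := expect_abs_Dfun_cm_sub_le blk hΔc (0 : α → ℝ) hs (fun x => blk x ≠ a) hPn hfar'
    (interpForm blk (interpForm blk Δ (corner ℝ Λc)) s) rfl
    ((blkIn (fun x => blk x ≠ a) (interpForm blk (interpForm blk Δ (corner ℝ Λc)) s))⁻¹ *
      blkMix (fun x => blk x ≠ a) (interpForm blk (interpForm blk Δ (corner ℝ Λc)) s)) rfl
    ((blkIn (fun x => blk x ≠ a) (interpForm blk (interpForm blk Δ (corner ℝ Λc)) s))⁻¹ *ᵥ resIn (fun x => blk x ≠ a) 0) rfl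
    ((interpForm blk (interpForm blk Δ (corner ℝ Λc)) s)⁻¹ *ᵥ 0) rfl
  refine hmaj.trans ?_
  have hd0 : (blkIn (fun x => blk x ≠ a) (interpForm blk (interpForm blk Δ (corner ℝ Λc)) s))⁻¹ *ᵥ
      resIn (fun x => blk x ≠ a) (0 : α → ℝ) = 0 := by
    rw [show resIn (fun x => blk x ≠ a) (0 : α → ℝ) = 0 from rfl, mulVec_zero]
  have hm' : ∀ k : Out (fun x => blk x ≠ a), (interpForm blk (interpForm blk Δ (corner ℝ Λc)) s)⁻¹ k.1 k.1 +
      ((interpForm blk (interpForm blk Δ (corner ℝ Λc)) s)⁻¹ *ᵥ (0 : α → ℝ)) k.1 ^ 2 ≤ m⁻¹ := fun k => by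
    rw [mulVec_zero, Pi.zero_apply, sq, mul_zero, add_zero]; exact inv_apply_self_le hA hm hmA k.1
  have hm0' : ∀ k : Out (fun x => blk x ≠ a), 0 ≤ (interpForm blk (interpForm blk Δ (corner ℝ Λc)) s)⁻¹ k.1 k.1 +
      ((interpForm blk (interpForm blk Δ (corner ℝ Λc)) s)⁻¹ *ᵥ (0 : α → ℝ)) k.1 ^ 2 := fun k =>
    add_nonneg hA.inv.posSemidef.diag_nonneg (sq_nonneg _)
  have hC : 0 ≤ (W * (c₁ * δ ^ D * R)) ^ 2 * m⁻¹ := mul_nonneg (sq_nonneg _) (inv_nonneg.2 hm.le)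
  refine (majorant_le_of_rows blk (fun x => blk x ≠ a) s n (interpForm blk Δ (corner ℝ Λc)) _ _ _ _ hd0 (inv_nonneg.2 hm.le)
    hm' hm0' (fun j => blk j.1 ∈ X'' ∧ ∃ y, blk y = n ∧ Δ y j.1 ≠ 0)
    (fun x hx => rowSum_boundary_le_chainN blk hab X'' hnbr hW hR0 hR ds hc₁ hδ0 hδ1 D hgeo Λc hs hs0 hdec x hx)
    (fun i j => |Δ i.1 j.1|) (fun _ _ => abs_nonneg _) (fun i j _ _ => ?_) (fun i j hi hj hq => ?_)).trans ?_
  · -- the coefficients: `|s_{□y}(Δ_{1_{Λ′}})_{xy}| ≤ |Δ_{xy}|`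
    rw [abs_mul, abs_of_nonneg (hs _).1]
    exact (mul_le_of_le_one_left (abs_nonneg _) (hs _).2).trans (abs_interpForm_apply_le blk Δ hcs _ _)
  · -- the coefficients vanish off the `□_n`-coupled sites of `X″`
    push Not at hq
    by_cases hjX : blk j.1 ∈ X''
    · rw [interpForm_apply_eq_zero blk Δ _ (hq hjX _ hi), mul_zero]
    · rw [hs0 _ hjX, zero_mul]
  · -- the `|Δ|`-weight of the pairs is `≤ W·R`
    have hsum := sum_sum_abs_le blk (fun x => blk x ≠ a) n hW hR0 hR
    calc ∑ i : In (fun x => blk x ≠ a), ∑ j : In (fun x => blk x ≠ a),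
          (if blk i.1 = n ∧ blk j.1 ≠ n then |Δ i.1 j.1| else 0) * ((W * (c₁ * δ ^ D * R)) ^ 2 * m⁻¹)
        = (∑ i : In (fun x => blk x ≠ a), ∑ j : In (fun x => blk x ≠ a),
            if blk i.1 = n ∧ blk j.1 ≠ n then |Δ i.1 j.1| else 0) * ((W * (c₁ * δ ^ D * R)) ^ 2 * m⁻¹) := by simp only [sum_mul]
      _ ≤ (W * R) * ((W * (c₁ * δ ^ D * R)) ^ 2 * m⁻¹) := mul_le_mul_of_nonneg_right hsum hC
      _ = W * R * ((W * (c₁ * δ ^ D * R)) ^ 2 * m⁻¹) := rfl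

end Literature.MathematicalPhysics.QuantumFieldTheory.BalabanImbrieJaffe1984to88.BIJ88EndChainNFluct309

end
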